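import Summits.QuantumFields.BalabanUV.Beta.EriceFlowEnclosureB12AsPrintedPointwiseFadingOrderSharpWitnessEnd

/-!
# Beta / EriceFlowEnclosureB12AsPrintedPointwiseFadingOrderSharpFold — WHAT (0.31) FORCES POINTWISE, part 7♯, FROM ORDER REVERSAL TO A FOLD: the toolkit.  `…SharpWitnessEnd`
# reverses the ORDER of two runs of the clamp family above the edge 2(1 − √θ)²; for UNIQUENESS («g₀ = g₀(ε, g)» a function) one needs a FOLD — two different bare couplings with the
# same renormalized one.  The passage is the intermediate value theorem in the START s of the run: the depth-j coupling g_j(s) is a continuous function of s on [½, 1] as long as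
# every run from there exists up to depth j, it is < 1 at s = ½ (a run started far below stays far below for j steps) and ≥ 1 at the reversed start s₀ < 1, so g_j(s*) = 1 = the constant
# run's value for some s* ≤ s₀ < 1.  What makes this work ARBITRARILY CLOSE to the edge is the separation of two smallnesses of the clamp family: the BOX margin η (Cγ³ = C(1+η)³ ≤ c)
# and the CLAMP width τ ≤ η, which alone bounds |β_{k+1}| ≤ Cτ∕(1−θ) EVERYWHERE (§1 `beta_abs_le`) — so for τ small against the reversal depth N every run started in ]0, 1] drifts by
# at most N·Cτ∕(1−θ) ≤ η in the chart and stays in the box ]0, 1+η] (§2 **`crudeRun`**), while the reversal depth N does not grow as τ shrinks (the band coefficient c₋(τ) = C(1−τ)²∕(2+τ)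
# is antitone in τ, `coeffLower_antitone`).  §3 **`tbl_continuousOn`**: the forward table of (0.20) started at s is continuous in s ∈ [½, 1] at every entry up to depth N (induction
# over the table: finite sums, the clamp, x ↦ 1∕x² away from 0 and √ on radicands ≥ ¼).  The companion `…SharpFoldEnd` assembles: for every 0 < θ < 1 and EVERY c > 2(1 − √θ)² two
# DIFFERENT same-length runs of (0.20) inside a box with Cγ³ ≤ c, under `HistLipschitz` + `FadingMemory C θ`, with the SAME endpoint — the sharp threshold for UNIQUENESS is 2(1−√θ)² too
# (β-flow team, prover 2 = lower ∕ positivity side, unit `b2b-balaban-beta-bflow-p2`, gen 45; ROW AP-I × node U2's letters; a TOY FAMILY of ours)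

HONEST FRAMING (page 1 of everything the β sub-cell writes): discharging `BetaPertH` makes Bałaban's UV stability UNCONDITIONAL — a
real constructive-QFT result; it is NOT the continuum limit and NOT the Clay problem.  HONEST DEPENDENCY (cell reorg 2026-08-19,
verbatim): «continuum YM on T⁴ ⇐ BetaPertH ∧ nine spine estimates (0/9 proved); BetaPertH ⇐ (D1) ∧ (D4) ∧ CAP+tail; G-an2-4 gates
asym, D1 and NE2/3/4.»  THIS MODULE DISCHARGES NOTHING: it is elementary real analysis (finite sums, continuity of compositions) about an EXPLICIT TOY family (ours
— NOT Bałaban's β of [I] = T. Bałaban, Commun. Math. Phys. **109** (1987) [Balaban1987RG1] (1.22) p. 264) and the forward solutions of the recursion (0.20) p. 256 for it;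
node U2's `HistLipschitz` ∕ `FadingMemory` are UNPRINTED hypothesis shapes (GAPS G-t4-U2-2; p. 298).  Uniqueness of g₀ is NOT printed (Theorem 2 p. 259 is an existence
statement, STATED WITHOUT PROOF — custodian's DELTA-I D-21).

WHAT THIS FILE PROVES (0 sorry, 0 def): §1 `sum_pow_rev_le`, **`beta_abs_le`**, `coeffLower_antitone`, `le_one_add_of_inv_sq`; §2 **`crudeRun`**; §3 **`tbl_continuousOn`**.
NOT CLAIMED: anything about Bałaban's β; Theorem 2; `BetaPertH`; continuum; Clay.
-/

namespace Summit.QuantumFields.BalabanUV.Beta.EriceFlowEnclosureB12AsPrintedPointwiseFadingOrderSharpFold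

open Finset Set
open Literature.MathematicalPhysics.QuantumFieldTheory.Balaban1983to89
open Literature.MathematicalPhysics.QuantumFieldTheory.Balaban1983to89.FlowStep (HBeta prefixOf Box mem_box RGEqH)
open Literature.MathematicalPhysics.QuantumFieldTheory.Balaban1983to89.T4CouplingMatching (HistLipschitz FadingMemory)
open Summit.QuantumFields.BalabanUV.Beta.EriceFlowEnclosureB12AsPrintedHistoryUniqueMono (geom_tail_le)
open Summit.QuantumFields.BalabanUV.Beta.EriceFlowEnclosureB12AsPrintedHistoryNonuniqueForward (fwd_stable fwd_d020)
open Summit.QuantumFields.BalabanUV.Beta.EriceFlowEnclosureB12AsPrintedPointwiseFadingOrderSharpWitness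

noncomputable section

variable {β : HBeta} {C θ τ : ℝ}

/-! ## §1 Elementary bounds -/

/-- Σ_{i≤k} θ^{k−i} ≤ 1∕(1 − θ) for 0 ≤ θ < 1 (reflect and `geom_tail_le`). [folklore] -/
theorem sum_pow_rev_le (hθ0 : 0 ≤ θ) (hθ1 : θ < 1) (k : ℕ) :
    ∑ i ∈ range (k + 1), θ ^ (k - i) ≤ 1 / (1 - θ) := by
  have h := geom_tail_le hθ0 hθ1 0 (k + 1)
  simp only [Nat.Ico_zero_eq_range, Nat.sub_zero] at h
  calc ∑ i ∈ range (k + 1), θ ^ (k - i) = ∑ i ∈ range (k + 1), θ ^ (k + 1 - 1 - i) :=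
        Finset.sum_congr rfl fun i _ => by rw [show k + 1 - 1 - i = k - i by omega]
    _ = ∑ i ∈ range (k + 1), θ ^ i := Finset.sum_range_reflect (fun i => θ ^ i) (k + 1)
    _ ≤ 1 / (1 - θ) := h

/-- **THE CLAMP FAMILY IS UNIFORMLY SMALL**: |β_{k+1}(p)| ≤ Cτ∕(1 − θ) for EVERY prefix p (C ≥ 0, 0 ≤ θ < 1, τ ≥ 0) — the clamp bounds each term by Cθ^{age}τ.  This is the
smallness that is independent of the box. [folklore] -/
theorem beta_abs_le
    (hβ : ∀ (k : ℕ) (p : Fin (k + 1) → ℝ), β k p = C * ∑ i : Fin (k + 1), θ ^ (k - (i : ℕ)) * max (-τ) (min τ (1 - p i)))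
    (hC : 0 ≤ C) (hθ0 : 0 ≤ θ) (hθ1 : θ < 1) (hτ : 0 ≤ τ) (k : ℕ) (p : Fin (k + 1) → ℝ) :
    |β k p| ≤ C * τ / (1 - θ) := by
  rw [hβ, abs_mul, abs_of_nonneg hC]
  have hsum : |∑ i : Fin (k + 1), θ ^ (k - (i : ℕ)) * max (-τ) (min τ (1 - p i))| ≤ τ * (1 / (1 - θ)) := by
    calc |∑ i : Fin (k + 1), θ ^ (k - (i : ℕ)) * max (-τ) (min τ (1 - p i))|
        ≤ ∑ i : Fin (k + 1), |θ ^ (k - (i : ℕ)) * max (-τ) (min τ (1 - p i))| := Finset.abs_sum_le_sum_abs _ _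
      _ ≤ ∑ i : Fin (k + 1), θ ^ (k - (i : ℕ)) * τ := Finset.sum_le_sum fun i _ => by
          rw [abs_mul, abs_of_nonneg (pow_nonneg hθ0 _)]
          exact mul_le_mul_of_nonneg_left (clamp_abs_le hτ _) (pow_nonneg hθ0 _)
      _ = τ * ∑ i ∈ range (k + 1), θ ^ (k - i) := by
          rw [Finset.mul_sum, Finset.sum_range (fun i => τ * θ ^ (k - i))]
          exact Finset.sum_congr rfl fun i _ => by ring
      _ ≤ τ * (1 / (1 - θ)) := mul_le_mul_of_nonneg_left (sum_pow_rev_le hθ0 hθ1 k) hτ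
  calc C * |∑ i : Fin (k + 1), θ ^ (k - (i : ℕ)) * max (-τ) (min τ (1 - p i))|
      ≤ C * (τ * (1 / (1 - θ))) := mul_le_mul_of_nonneg_left hsum hC
    _ = C * τ / (1 - θ) := by ring

/-- **THE BAND COEFFICIENT IS ANTITONE IN THE CLAMP WIDTH**: 0 ≤ τ ≤ τ₁ ≤ 1, C ≥ 0 ⟹ C(1−τ₁)²∕(2+τ₁) ≤ C(1−τ)²∕(2+τ) — shrinking the clamp only raises the coefficient that
drives the oscillation, so the reversal depth computed at τ₁ serves every τ ≤ τ₁. [folklore] -/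
theorem coeffLower_antitone {τ₁ : ℝ} (hC : 0 ≤ C) (hτ0 : 0 ≤ τ) (hτ : τ ≤ τ₁) (hτ₁ : τ₁ ≤ 1) :
    C * ((1 - τ₁) ^ 2 / (2 + τ₁)) ≤ C * ((1 - τ) ^ 2 / (2 + τ)) := by
  refine mul_le_mul_of_nonneg_left ?_ hC
  rw [div_le_div_iff₀ (by linarith) (by linarith)]
  have h1 : (1 - τ₁) ^ 2 ≤ (1 - τ) ^ 2 := pow_le_pow_left₀ (by linarith) (by linarith) 2
  nlinarith [mul_le_mul_of_nonneg_left (by linarith : 2 + τ ≤ 2 + τ₁) (sq_nonneg (1 - τ₁)),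
    mul_le_mul_of_nonneg_right h1 (by linarith : (0 : ℝ) ≤ 2 + τ₁)]

/-- From the chart to the coupling, upper side: 1 − η ≤ 1∕a² with 0 ≤ η ≤ ½ ⟹ a ≤ 1 + η (since (1 − η)(1 + η)² ≥ 1). [folklore] -/
theorem le_one_add_of_inv_sq {a η : ℝ} (hη0 : 0 ≤ η) (hη1 : η ≤ 1 / 2) (h : 1 - η ≤ 1 / a ^ 2) :
    a ≤ 1 + η := by
  rcases le_or_gt a (1 + η) with h1 | h1
  · exact h1
  · exfalso
    have hlt : 1 / a ^ 2 < 1 / (1 + η) ^ 2 :=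
      one_div_lt_one_div_of_lt (by positivity) (pow_lt_pow_left₀ h1 (by linarith) two_ne_zero)
    have hle : 1 / (1 + η) ^ 2 ≤ 1 - η := by
      rw [div_le_iff₀ (by positivity)]
      nlinarith [mul_nonneg hη0 (by nlinarith : (0 : ℝ) ≤ 1 - η - η ^ 2)]
    linarith

/-! ## §2 Every run started in ]0, 1] exists and drifts by at most N·Cτ∕(1−θ) in the chart -/

/-- **THE CRUDE RUN.**  Clamp family (C ≥ 0, 0 ≤ θ < 1, τ ≥ 0), drift bound B := Cτ∕(1−θ), a depth n with n·B ≤ ¾, a start 0 < s ≤ 1 and the forward table of (0.20) started at s: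
for every k ≤ n the diagonal is POSITIVE with 1∕g_k² ≥ 1∕s² − k·B (≥ ¼), and it solves (0.20) up to n.  (Each step changes the chart value by −β with |β| ≤ B — `beta_abs_le` —, so the
radicand stays ≥ 1 − (k+1)B ≥ ¼ > 0 and `fwd_d020` applies.)  No band condition: the clamp does the work. [cite: Balaban1987RG1, (0.20) p.256 with p.298] -/
theorem crudeRun
    (hβ : ∀ (k : ℕ) (p : Fin (k + 1) → ℝ), β k p = C * ∑ i : Fin (k + 1), θ ^ (k - (i : ℕ)) * max (-τ) (min τ (1 - p i)))
    (hC : 0 ≤ C) (hθ0 : 0 ≤ θ) (hθ1 : θ < 1) (hτ : 0 ≤ τ)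
    {s : ℝ} (hs0 : 0 < s) (hs1 : s ≤ 1) {n : ℕ} (hn : (n : ℝ) * (C * τ / (1 - θ)) ≤ 3 / 4)
    {tbl : ℕ → ℕ → ℝ}
    (hcs : ∀ k i, tbl (k + 1) i =
      if i ≤ k then tbl k i else 1 / Real.sqrt (1 / (tbl k k) ^ 2 - β k (fun j : Fin (k + 1) => tbl k j)))
    (h0 : tbl 0 0 = s) :
    (∀ k, k ≤ n → 0 < tbl k k ∧ 1 / s ^ 2 - k * (C * τ / (1 - θ)) ≤ 1 / (tbl k k) ^ 2) ∧
      RGEqH n β (fun k => tbl k k) := by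
  set B : ℝ := C * τ / (1 - θ) with hB
  have hB0 : 0 ≤ B := by rw [hB]; exact div_nonneg (mul_nonneg hC hτ) (by linarith)
  have hs2 : 1 ≤ 1 / s ^ 2 := by
    rw [le_div_iff₀ (by positivity)]; nlinarith
  have main : ∀ k, k ≤ n →
      (∀ i, i ≤ k → 0 < tbl i i ∧ 1 / s ^ 2 - i * B ≤ 1 / (tbl i i) ^ 2) ∧ RGEqH k β (fun k => tbl k k) := by
    intro k
    induction k with
    | zero =>
      intro _
      refine ⟨fun i hi => ?_, fun j hj => absurd hj (Nat.not_lt_zero _)⟩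
      obtain rfl := Nat.le_zero.mp hi
      rw [h0, Nat.cast_zero, zero_mul, sub_zero]
      exact ⟨hs0, le_rfl⟩
    | succ k ih =>
      intro hk
      obtain ⟨hin, hrg⟩ := ih (Nat.le_of_succ_le hk)
      have hxk := (hin k le_rfl).2
      have hβk := (abs_le.mp (beta_abs_le hβ hC hθ0 hθ1 hτ k (prefixOf (fun i => tbl i i) k))).2
      have hk1 : ((k : ℝ) + 1) * B ≤ 3 / 4 := by
        have hkn : (k : ℝ) + 1 ≤ n := by exact_mod_cast hk
        exact (mul_le_mul_of_nonneg_right hkn hB0).trans hn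
      have hxpos : 0 < 1 / (tbl k k) ^ 2 - β k (prefixOf (fun i => tbl i i) k) := by nlinarith
      have hd := fwd_d020 hcs k hxpos
      refine ⟨fun i hi => ?_, fun j hj => ?_⟩
      · rcases Nat.lt_or_eq_of_le hi with hlt | rfl
        · exact hin i (Nat.lt_succ_iff.mp hlt)
        · refine ⟨hd.1, ?_⟩
          have e : 1 / (tbl (k + 1) (k + 1)) ^ 2 = 1 / (tbl k k) ^ 2 - β k (prefixOf (fun i => tbl i i) k) := by
            linarith [hd.2]
          rw [e]; push_cast; nlinarith
      · rcases Nat.lt_or_eq_of_le (Nat.lt_succ_iff.mp hj) with hlt | rfl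
        · exact hrg j hlt
        · exact hd.2
  exact main n le_rfl

/-! ## §3 The forward table is continuous in the start -/

/-- **CONTINUITY OF THE RUN IN ITS START.**  Clamp family (C ≥ 0, 0 ≤ θ < 1, τ ≥ 0), depth n with n·Cτ∕(1−θ) ≤ ¾, and the forward tables `tbl s` of (0.20) started at the points
s (`tbl s 0 i = s`): for every k ≤ n and every index i, `s ↦ tbl s k i` is CONTINUOUS on [½, 1].  (Induction over the table: below the diagonal the entry is copied; on it the entry is
1∕√R(s) with R(s) = 1∕(tbl s k k)² − C Σ_j θ^{k−j} φ_τ(1 − tbl s k j) — finite sums, max∕min, x ↦ 1∕x² on positive values and √ on R ≥ ¼ by `crudeRun`.) [folklore] -/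
theorem tbl_continuousOn
    (hβ : ∀ (k : ℕ) (p : Fin (k + 1) → ℝ), β k p = C * ∑ i : Fin (k + 1), θ ^ (k - (i : ℕ)) * max (-τ) (min τ (1 - p i)))
    (hC : 0 ≤ C) (hθ0 : 0 ≤ θ) (hθ1 : θ < 1) (hτ : 0 ≤ τ)
    {n : ℕ} (hn : (n : ℝ) * (C * τ / (1 - θ)) ≤ 3 / 4)
    {tbl : ℝ → ℕ → ℕ → ℝ}
    (hcs : ∀ s k i, tbl s (k + 1) i =
      if i ≤ k then tbl s k i else 1 / Real.sqrt (1 / (tbl s k k) ^ 2 - β k (fun j : Fin (k + 1) => tbl s k j)))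
    (h0 : ∀ s i, tbl s 0 i = s) :
    ∀ k, k ≤ n → ∀ i, ContinuousOn (fun s => tbl s k i) (Icc (1 / 2 : ℝ) 1) := by
  intro k
  induction k with
  | zero =>
    intro _ i
    exact continuousOn_id.congr (fun s _ => h0 s i)
  | succ k ih =>
    intro hk i
    have ihk := ih (Nat.le_of_succ_le hk)
    by_cases hik : i ≤ k
    · exact (ihk i).congr (fun s _ => by rw [hcs s k i, if_pos hik])
    · -- facts along every start in [1/2, 1] from the crude run
      have hfacts : ∀ s ∈ Icc (1 / 2 : ℝ) 1,
          0 < tbl s k k ∧ 0 < 1 / (tbl s k k) ^ 2 - β k (fun j : Fin (k + 1) => tbl s k j) := by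
        intro s hs
        have hs0 : 0 < s := by linarith [hs.1]
        obtain ⟨hin, _⟩ := crudeRun hβ hC hθ0 hθ1 hτ hs0 hs.2 hn (hcs s) (h0 s 0)
        have hkn : k < n := Nat.lt_of_succ_le hk
        obtain ⟨hposk, hxk⟩ := hin k hkn.le
        refine ⟨hposk, ?_⟩
        have hpre : (fun j : Fin (k + 1) => tbl s k j) = prefixOf (fun i => tbl s i i) k := by
          funext j
          rw [FlowStep.prefixOf_apply, fwd_stable (hcs s) k j (Nat.lt_succ_iff.mp j.isLt)]
        rw [hpre]
        have hβk := (abs_le.mp (beta_abs_le hβ hC hθ0 hθ1 hτ k (prefixOf (fun i => tbl s i i) k))).2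
        have hB0 : 0 ≤ C * τ / (1 - θ) := div_nonneg (mul_nonneg hC hτ) (by linarith)
        have hk1 : ((k : ℝ) + 1) * (C * τ / (1 - θ)) ≤ 3 / 4 := by
          have hkn' : (k : ℝ) + 1 ≤ n := by exact_mod_cast hk
          exact (mul_le_mul_of_nonneg_right hkn' hB0).trans hn
        have hs2 : 1 ≤ 1 / s ^ 2 := by
          rw [le_div_iff₀ (by positivity)]; nlinarith [hs.2]
        nlinarith
      have hR : ContinuousOn (fun s => 1 / (tbl s k k) ^ 2 - β k (fun j : Fin (k + 1) => tbl s k j)) (Icc (1 / 2 : ℝ) 1) := by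
        refine ContinuousOn.sub ?_ ?_
        · exact continuousOn_const.div ((ihk k).pow 2) (fun s hs => pow_ne_zero 2 (hfacts s hs).1.ne')
        · have e : (fun s => β k (fun j : Fin (k + 1) => tbl s k j))
              = fun s => C * ∑ j : Fin (k + 1), θ ^ (k - (j : ℕ)) * max (-τ) (min τ (1 - tbl s k j)) := by
            funext s; rw [hβ]
          rw [e]
          exact continuousOn_const.mul (continuousOn_finsetSum _ fun j _ =>
            continuousOn_const.mul (continuousOn_const.sup (continuousOn_const.inf (continuousOn_const.sub (ihk j)))))
      have hcont : ContinuousOn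
          (fun s => 1 / Real.sqrt (1 / (tbl s k k) ^ 2 - β k (fun j : Fin (k + 1) => tbl s k j))) (Icc (1 / 2 : ℝ) 1) :=
        continuousOn_const.div hR.sqrt (fun s hs => (Real.sqrt_pos.mpr (hfacts s hs).2).ne')
      exact hcont.congr (fun s _ => by rw [hcs s k i, if_neg hik])

end

end Summit.QuantumFields.BalabanUV.Beta.EriceFlowEnclosureB12AsPrintedPointwiseFadingOrderSharpFold
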